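import Mathlib
import Summits.Ventures.LatticeQCDFlow.TrivializingMaps.AcceptanceFootprint
import Summits.Ventures.LatticeQCDFlow.TrivializingMaps.AcceptanceCurveFourPoint
import HarnessLib

/-!
# THEOREM Q♯♯ (partial): the exact acceptance/correlation curve `4 acc (1 - acc)` on `[½, 2/3]`

HONEST FRAMING. exact (Metropolis-corrected) sampling algorithms for lattice gauge theory; figures of
merit are autocorrelation/cost numbers at stated couplings and volumes; no continuum-physics claim.

Setting of the tree's THEOREM Q (`AcceptanceFootprint.abs_cov_le_of_meanAccept`): reference measure
`μ`, target density `p`, model (flow push-forward / proposal) density `q`, equilibrium mean acceptance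
of the independence sampler `acc ≤ ∫∫ min(p x q y, p y q x)`, bounded witnesses `|A| ≤ a`, `|B| ≤ b`
that the MODEL decorrelates (`E_q[AB] = E_q[A] E_q[B]`).  THEOREM Q bounds the TARGET's connected
correlation by `6 (1 - acc) a b`, THEOREM Q♯ (`AcceptanceFootprintSharp`) by `4 (1 - acc) a b`.

## What is proved here (`a, b > 0`; all `sorry`-free)
* `two_mul_abs_cov_le_of_meanAccept` (Q♯♯ (i)):  `2 |Cov_p(A,B)| ≤ (2 - acc)² a b` — strictly sharper
  than Q♯ for `acc < 2√2 - 2`, equality on the corner family of `AcceptanceFootprintFloor` at `acc = 2/3`.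
* `abs_cov_le_max_of_meanAccept` (Q♯♯ (ii)):  for `acc ≥ ½`,
  `|Cov_p(A,B)| ≤ max(8/9, 4 acc (1 - acc)) · a b`.  On `½ ≤ acc ≤ 2/3` the bound `4 acc (1 - acc) a b`
  is ATTAINED by the corner family (`acc = 1 - λ`, `Cov = 4 λ (1 - λ) a b`), so the sharp footprint
  function `g♯(acc) := sup |Cov|/(a b)` EQUALS `4 acc (1 - acc)` on `[½, 2/3]`.
* `meanAccept_le_half_of_abs_cov_ge` (acceptance ceiling): a decorrelated witness pair of full strength
  `|Cov_p| ≥ a b` forces `acc ≤ ½` (Q♯ gave `¾`; `½` is attained by the floor family).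
* The mechanism, of independent interest: `meanAccept_le_sum_min` — pushing target and model forward
  along ANY finite measurable partition of unity (a stochastic rounding) can only RAISE the mean
  acceptance (Jensen for `min` in product form); `curve_core` applies it to the rounding kernel
  `κ_{στ} = (1 + σ A)(1 + τ B)/4`, which preserves `Cov(A,B)`, the product structure of the model, and
  lands in the four-point algebra of `AcceptanceCurveFourPoint` (`sum_min_curve`).

## NOT CLAIMED
* The full conjecture Q♯♯ `|Cov| ≤ 4 acc (1 - acc) a b` for all `acc ≥ ½` (open on `(2/3, 1]`; on
  `[2/3, 0.83]` the best proved bound is (i), above `0.83` it is Q♯'s `4 (1 - acc)`).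
* Degenerate bounds `a = 0` or `b = 0` (then `Cov = 0` trivially) are excluded by hypothesis.
* Nothing about trivializing maps beyond THEOREM Q's abstract sampler setting; Lüscher's smooth /
  perturbative statements stay cited facts (`Literature`), not used here.

References: M. Lüscher, CMP 293 (2010) 899–919, arXiv:0907.5491 [Luscher2010Trivializing] (context);
tree files `AcceptanceFootprint` (THEOREM Q), `Exactness.FlowAcceptanceOverlap` (acceptance integrals).
-/

namespace Summit.Ventures.LatticeQCDFlow.TrivializingMaps.Curve

/-! ## §2. Rounding: a finite measurable partition of unity can only raise the acceptance -/

section Rounding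

open MeasureTheory

variable {X : Type*} [MeasurableSpace X] {μ : Measure X} {p q : X → ℝ}

/-- `∫ min(f, g) ≤ min(∫ f, ∫ g)`. -/
theorem integral_min_le {f g : X → ℝ} (hf : Integrable f μ) (hg : Integrable g μ) :
    ∫ x, min (f x) (g x) ∂μ ≤ min (∫ x, f x ∂μ) (∫ x, g x ∂μ) :=
  le_min (integral_mono (hf.inf hg) hf fun _ => min_le_left _ _)
    (integral_mono (hf.inf hg) hg fun _ => min_le_right _ _)

variable [SFinite μ]

/-- **ROUNDING RAISES THE ACCEPTANCE.**  For densities `p, q ≥ 0` (`∫ q = 1`) and a finite measurable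
partition of unity `κ_z ≥ 0`, `Σ_z κ_z = 1` (a Markov kernel to the finite set `ι`), the rounded cell masses
`x_z = ∫ p κ_z`, `y_z = ∫ q κ_z` satisfy `ā = ∫∫ min(p(u)q(v), p(v)q(u)) ≤ Σ_{z,w} min(x_z y_w, x_w y_z)`
(= the acceptance of the independence sampler between the rounded laws): `min` of integrals dominates the
integral of the `min`, twice. -/
theorem meanAccept_le_sum_min {ι : Type*} [Fintype ι] (hp0 : ∀ x, 0 ≤ p x) (hpm : Measurable p)
    (hpi : Integrable p μ) (hq0 : ∀ x, 0 ≤ q x) (hqm : Measurable q) (hqi : Integrable q μ)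
    (hq1 : ∫ x, q x ∂μ = 1) (κ : ι → X → ℝ) (hκm : ∀ z, Measurable (κ z)) (hκ0 : ∀ z u, 0 ≤ κ z u)
    (hκ1 : ∀ z u, κ z u ≤ 1) (hκs : ∀ u, ∑ z, κ z u = 1) {x y : ι → ℝ}
    (hx : ∀ z, x z = ∫ u, p u * κ z u ∂μ) (hy : ∀ z, y z = ∫ u, q u * κ z u ∂μ) :
    ∫ u, ∫ v, min (p u * q v) (p v * q u) ∂μ ∂μ ≤ ∑ z, ∑ w, min (x z * y w) (x w * y z) := by
  have hκb : ∀ z u, |κ z u| ≤ 1 := fun z u => abs_le.2 ⟨by linarith [hκ0 z u], hκ1 z u⟩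
  have hpk : ∀ z, Integrable (fun u => p u * κ z u) μ := fun z =>
    integrable_density_mul hpm hpi (hκm z) (hκb z)
  have hqk : ∀ z, Integrable (fun u => q u * κ z u) μ := fun z =>
    integrable_density_mul hqm hqi (hκm z) (hκb z)
  -- inner step, pointwise in `u`
  have hinner : ∀ u, ∫ v, min (p u * q v) (p v * q u) ∂μ ≤ ∑ w, min (p u * y w) (q u * x w) := by
    intro u
    have hm := Exactness.integrable_min_mul (μ := μ) hp0 hpm hq0 hqm hqi u
    have hmm : Measurable fun v => min (p u * q v) (p v * q u) :=
      (measurable_const.mul hqm).min (hpm.mul measurable_const)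
    calc ∫ v, min (p u * q v) (p v * q u) ∂μ
        = ∫ v, ∑ w, min (p u * q v) (p v * q u) * κ w v ∂μ := by
          refine integral_congr_ae (Filter.Eventually.of_forall fun v => ?_)
          simp only [← Finset.mul_sum, hκs v, mul_one]
      _ = ∑ w, ∫ v, min (p u * q v) (p v * q u) * κ w v ∂μ :=
          integral_finsetSum _ fun w _ => integrable_density_mul hmm hm (hκm w) (hκb w)
      _ ≤ ∑ w, min (p u * y w) (q u * x w) := Finset.sum_le_sum fun w _ => ?_
    have e : ∀ v, min (p u * q v) (p v * q u) * κ w v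
        = min (p u * (q v * κ w v)) (q u * (p v * κ w v)) := fun v => by
      rw [min_mul_of_nonneg _ _ (hκ0 w v)]; congr 1 <;> ring
    simp_rw [e]
    rw [show p u * y w = ∫ v, p u * (q v * κ w v) ∂μ by rw [hy, integral_const_mul],
      show q u * x w = ∫ v, q u * (p v * κ w v) ∂μ by rw [hx, integral_const_mul]]
    exact integral_min_le ((hqk w).const_mul _) ((hpk w).const_mul _)
  -- outer step, for each rounded cell `w`
  have hmin : ∀ w, Integrable (fun u => min (p u * y w) (q u * x w)) μ := fun w =>
    (hpi.mul_const _).inf (hqi.mul_const _)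
  have houter : ∀ w, ∫ u, min (p u * y w) (q u * x w) ∂μ ≤ ∑ z, min (x z * y w) (x w * y z) := by
    intro w
    have hmm : Measurable fun u => min (p u * y w) (q u * x w) :=
      (hpm.mul measurable_const).min (hqm.mul measurable_const)
    calc ∫ u, min (p u * y w) (q u * x w) ∂μ
        = ∫ u, ∑ z, min (p u * y w) (q u * x w) * κ z u ∂μ := by
          refine integral_congr_ae (Filter.Eventually.of_forall fun u => ?_)
          simp only [← Finset.mul_sum, hκs u, mul_one]
      _ = ∑ z, ∫ u, min (p u * y w) (q u * x w) * κ z u ∂μ :=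
          integral_finsetSum _ fun z _ => integrable_density_mul hmm (hmin w) (hκm z) (hκb z)
      _ ≤ ∑ z, min (x z * y w) (x w * y z) := Finset.sum_le_sum fun z _ => ?_
    have e : ∀ u, min (p u * y w) (q u * x w) * κ z u
        = min (p u * κ z u * y w) (q u * κ z u * x w) := fun u => by
      rw [min_mul_of_nonneg _ _ (hκ0 z u)]; congr 1 <;> ring
    simp_rw [e]
    rw [show x z * y w = ∫ u, p u * κ z u * y w ∂μ by rw [hx z, integral_mul_const],
      show x w * y z = ∫ u, q u * κ z u * x w ∂μ by rw [hy z, integral_mul_const, mul_comm]]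
    exact integral_min_le ((hpk z).mul_const _) ((hqk z).mul_const _)
  calc ∫ u, ∫ v, min (p u * q v) (p v * q u) ∂μ ∂μ
      ≤ ∫ u, ∑ w, min (p u * y w) (q u * x w) ∂μ :=
        integral_mono (Exactness.integrable_integral_min_mul hp0 hpm hpi hq0 hqm hqi hq1)
          (integrable_finsetSum _ fun w _ => hmin w) hinner
    _ = ∑ w, ∫ u, min (p u * y w) (q u * x w) ∂μ := integral_finsetSum _ fun w _ => hmin w
    _ ≤ ∑ w, ∑ z, min (x z * y w) (x w * y z) := Finset.sum_le_sum fun w _ => houter w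
    _ = ∑ z, ∑ w, min (x z * y w) (x w * y z) := Finset.sum_comm

end Rounding

/-! ## §3. The curve: rounding by the witnesses `A`, `B` themselves -/

section Curve

open MeasureTheory

variable {X : Type*} [MeasurableSpace X] {μ : Measure X} {p q : X → ℝ}

/-- `|∫ q h| ≤ c` for a density `q` (`∫ q = 1`) and `|h| ≤ c`. -/
theorem abs_integral_density_mul_le (hq0 : ∀ x, 0 ≤ q x) (hqm : Measurable q) (hqi : Integrable q μ)
    (hq1 : ∫ x, q x ∂μ = 1) {h : X → ℝ} (hm : Measurable h) {c : ℝ} (hb : ∀ x, |h x| ≤ c) :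
    |∫ x, q x * h x ∂μ| ≤ c := by
  have hi := integrable_density_mul hqm hqi hm hb
  calc |∫ x, q x * h x ∂μ| ≤ ∫ x, |q x * h x| ∂μ := abs_integral_le_integral_abs
    _ ≤ ∫ x, q x * c ∂μ := by
        refine integral_mono hi.abs (hqi.mul_const c) fun x => ?_
        dsimp only
        rw [abs_mul, abs_of_nonneg (hq0 x)]
        exact mul_le_mul_of_nonneg_left (hb x) (hq0 x)
    _ = c := by rw [integral_mul_const, hq1, one_mul]

/-- The rounded cell mass in closed form:
`∫ p · (1 + e A)(1 + d B)/4 = (∫ p + e ∫ p A + d ∫ p B + e d ∫ p A B)/4`. -/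
theorem integral_density_round (hpm : Measurable p) (hpi : Integrable p μ) {A B : X → ℝ}
    (hAm : Measurable A) (hBm : Measurable B) (hA : ∀ x, |A x| ≤ 1) (hB : ∀ x, |B x| ≤ 1) (e d : ℝ) :
    ∫ u, p u * ((1 + e * A u) * (1 + d * B u) / 4) ∂μ
      = ((∫ u, p u ∂μ) + e * ∫ u, p u * A u ∂μ + d * ∫ u, p u * B u ∂μ
          + e * d * ∫ u, p u * (A u * B u) ∂μ) / 4 := by
  have hAB : ∀ x, |A x * B x| ≤ 1 := fun x => by
    rw [abs_mul]; exact mul_le_one₀ (hA x) (abs_nonneg _) (hB x)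
  have hpA := integrable_density_mul hpm hpi hAm hA
  have hpB := integrable_density_mul hpm hpi hBm hB
  have hpAB := integrable_density_mul hpm hpi (hAm.mul hBm) hAB
  have ef : (fun u => p u * ((1 + e * A u) * (1 + d * B u) / 4))
      = fun u => (1 / 4) * (p u + e * (p u * A u) + d * (p u * B u)
          + e * d * (p u * (A u * B u))) := funext fun u => by ring
  rw [ef, integral_const_mul, integral_add, integral_add, integral_add, integral_const_mul,
    integral_const_mul, integral_const_mul]
  · ring
  all_goals first
    | exact hpi | exact hpA.const_mul _ | exact hpB.const_mul _ | exact hpAB.const_mul _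
    | exact hpi.add (hpA.const_mul _) | exact (hpi.add (hpA.const_mul _)).add (hpB.const_mul _)

variable [SFinite μ]

/-- **THE CURVE — normalised core** (`|A|, |B| ≤ 1`, integrals against the reference measure `μ`).
With `Cov = ∫ p A B - (∫ p A)(∫ p B)` and `A`, `B` uncorrelated under `q·μ`:
(i) `2 |Cov| ≤ (2 - acc)²`; (ii) if `acc ≥ ½` and `|Cov| ≥ 8/9` then `(2 acc - 1)² ≤ 1 - |Cov|`. -/
theorem curve_core (hp0 : ∀ x, 0 ≤ p x) (hpm : Measurable p) (hpi : Integrable p μ)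
    (hp1 : ∫ x, p x ∂μ = 1) (hq0 : ∀ x, 0 ≤ q x) (hqm : Measurable q) (hqi : Integrable q μ)
    (hq1 : ∫ x, q x ∂μ = 1) {acc : ℝ}
    (hacc : acc ≤ ∫ x, ∫ y, min (p x * q y) (p y * q x) ∂μ ∂μ) {A B : X → ℝ} (hAm : Measurable A)
    (hBm : Measurable B) (hA : ∀ x, |A x| ≤ 1) (hB : ∀ x, |B x| ≤ 1)
    (hfac : ∫ x, q x * (A x * B x) ∂μ = (∫ x, q x * A x ∂μ) * ∫ x, q x * B x ∂μ) :
    2 * |∫ x, p x * (A x * B x) ∂μ - (∫ x, p x * A x ∂μ) * ∫ x, p x * B x ∂μ| ≤ (2 - acc) ^ 2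
      ∧ (1 / 2 ≤ acc →
          8 / 9 ≤ |∫ x, p x * (A x * B x) ∂μ - (∫ x, p x * A x ∂μ) * ∫ x, p x * B x ∂μ| →
          (2 * acc - 1) ^ 2
            ≤ 1 - |∫ x, p x * (A x * B x) ∂μ - (∫ x, p x * A x ∂μ) * ∫ x, p x * B x ∂μ|) := by
  set α := ∫ x, p x * A x ∂μ with hαd
  set β := ∫ x, p x * B x ∂μ with hβd
  set γ := ∫ x, p x * (A x * B x) ∂μ with hγd
  set α' := ∫ x, q x * A x ∂μ with hα'd
  set β' := ∫ x, q x * B x ∂μ with hβ'd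
  -- spins, rounding weights (randomised rounding of `(A, B)` to `{±1}²`)
  let sg : Bool → ℝ := fun b => if b then 1 else -1
  let κ : Bool × Bool → X → ℝ := fun z u => (1 + sg z.1 * A u) * (1 + sg z.2 * B u) / 4
  have hsg : ∀ b, sg b = 1 ∨ sg b = -1 := fun b => by cases b <;> simp [sg]
  have hfA : ∀ b u, 0 ≤ 1 + sg b * A u ∧ 1 + sg b * A u ≤ 2 := fun b u => by
    have := abs_le.1 (hA u); rcases hsg b with h | h <;> rw [h] <;> constructor <;> linarith
  have hfB : ∀ b u, 0 ≤ 1 + sg b * B u ∧ 1 + sg b * B u ≤ 2 := fun b u => by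
    have := abs_le.1 (hB u); rcases hsg b with h | h <;> rw [h] <;> constructor <;> linarith
  have hκm : ∀ z, Measurable (κ z) := fun z =>
    ((measurable_const.add (measurable_const.mul hAm)).mul
      (measurable_const.add (measurable_const.mul hBm))).div_const 4
  have hκ0 : ∀ z u, 0 ≤ κ z u := fun z u =>
    div_nonneg (mul_nonneg (hfA z.1 u).1 (hfB z.2 u).1) (by norm_num)
  have hκ1 : ∀ z u, κ z u ≤ 1 := fun z u => by
    have h := mul_le_mul (hfA z.1 u).2 (hfB z.2 u).2 (hfB z.2 u).1 (by norm_num : (0:ℝ) ≤ 2)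
    show (1 + sg z.1 * A u) * (1 + sg z.2 * B u) / 4 ≤ 1
    linarith
  have hκs : ∀ u, ∑ z, κ z u = 1 := fun u => by
    simp only [κ, sg, Fintype.sum_prod_type, Fintype.sum_bool, if_true, if_false, Bool.false_eq_true]
    ring
  -- the rounded cell masses, in closed form
  let x : Bool × Bool → ℝ := fun z => (1 + sg z.1 * α + sg z.2 * β + sg z.1 * sg z.2 * γ) / 4
  set p' := (1 + α') / 2 with hp'd
  set q' := (1 + β') / 2 with hq'd
  let y : Bool × Bool → ℝ := fun z => (if z.1 then p' else 1 - p') * (if z.2 then q' else 1 - q')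
  have hx : ∀ z, x z = ∫ u, p u * κ z u ∂μ := fun z => by
    show _ = ∫ u, p u * ((1 + sg z.1 * A u) * (1 + sg z.2 * B u) / 4) ∂μ
    rw [integral_density_round hpm hpi hAm hBm hA hB, hp1]
  have hy : ∀ z, y z = ∫ u, q u * κ z u ∂μ := fun z => by
    show _ = ∫ u, q u * ((1 + sg z.1 * A u) * (1 + sg z.2 * B u) / 4) ∂μ
    rw [integral_density_round hqm hqi hAm hBm hA hB, hq1, hfac]
    rcases z with ⟨b₁, b₂⟩
    cases b₁ <;> cases b₂ <;>
      simp only [y, sg, hp'd, hq'd, if_true, if_false, Bool.false_eq_true] <;> ring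
  have hred := meanAccept_le_sum_min hp0 hpm hpi hq0 hqm hqi hq1 κ hκm hκ0 hκ1 hκs hx hy
  -- hypotheses of the four-point lemmas
  have hx0 : ∀ z, 0 ≤ x z := fun z => by
    rw [hx z]; exact integral_nonneg fun u => mul_nonneg (hp0 u) (hκ0 z u)
  have hxs : x (true, true) + x (true, false) + x (false, true) + x (false, false) = 1 := by
    simp only [x, sg, if_true, if_false, Bool.false_eq_true]; ring
  have hα' := abs_le.1 (abs_integral_density_mul_le hq0 hqm hqi hq1 hAm hA)
  have hβ' := abs_le.1 (abs_integral_density_mul_le hq0 hqm hqi hq1 hBm hB)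
  have hp'0 : 0 ≤ p' := by rw [hp'd]; linarith [hα'.1]
  have hp'1 : p' ≤ 1 := by rw [hp'd]; linarith [hα'.2]
  have hq'0 : 0 ≤ q' := by rw [hq'd]; linarith [hβ'.1]
  have hq'1 : q' ≤ 1 := by rw [hq'd]; linarith [hβ'.2]
  have hcov : x (true, true) * x (false, false) - x (true, false) * x (false, true)
      = (γ - α * β) / 4 := by
    simp only [x, sg, if_true, if_false, Bool.false_eq_true]; ring
  have key : 4 * |x (true, true) * x (false, false) - x (true, false) * x (false, true)|
      = |γ - α * β| := by
    rw [hcov, abs_div, abs_of_pos (by norm_num : (0:ℝ) < 4)]; ring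
  -- the four-point algebra (`AcceptanceCurveFourPoint.sum_min_curve`) on the rounded pair
  have hc := sum_min_curve x hx0 hxs hp'0 hp'1 hq'0 hq'1 (hacc.trans hred)
  refine ⟨by linarith [key, hc.1], fun hacc2 hreg => ?_⟩
  have hreg' : 8 / 9 ≤ 4 * |x (true, true) * x (false, false) - x (true, false) * x (false, true)| :=
    by rw [key]; exact hreg
  have h := hc.2 hacc2 hreg'
  rw [key] at h
  exact h

/-- **THE CURVE — scaled `μ`-form** (`|A| ≤ a`, `|B| ≤ b`, `a, b > 0`):
(i) `2 |Cov| ≤ (2 - acc)² a b`; (ii) for `acc ≥ ½`: `|Cov| ≥ (8/9) a b ⟹ |Cov| ≤ 4 acc (1 - acc) a b`. -/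
theorem curve_scaled (hp0 : ∀ x, 0 ≤ p x) (hpm : Measurable p) (hpi : Integrable p μ)
    (hp1 : ∫ x, p x ∂μ = 1) (hq0 : ∀ x, 0 ≤ q x) (hqm : Measurable q) (hqi : Integrable q μ)
    (hq1 : ∫ x, q x ∂μ = 1) {acc : ℝ}
    (hacc : acc ≤ ∫ x, ∫ y, min (p x * q y) (p y * q x) ∂μ ∂μ) {A B : X → ℝ} (hAm : Measurable A)
    (hBm : Measurable B) {a b : ℝ} (ha : 0 < a) (hb : 0 < b) (hA : ∀ x, |A x| ≤ a)
    (hB : ∀ x, |B x| ≤ b)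
    (hfac : ∫ x, q x * (A x * B x) ∂μ = (∫ x, q x * A x ∂μ) * ∫ x, q x * B x ∂μ) :
    2 * |∫ x, p x * (A x * B x) ∂μ - (∫ x, p x * A x ∂μ) * ∫ x, p x * B x ∂μ|
        ≤ (2 - acc) ^ 2 * (a * b)
      ∧ (1 / 2 ≤ acc →
          8 / 9 * (a * b) ≤ |∫ x, p x * (A x * B x) ∂μ - (∫ x, p x * A x ∂μ) * ∫ x, p x * B x ∂μ| →
          |∫ x, p x * (A x * B x) ∂μ - (∫ x, p x * A x ∂μ) * ∫ x, p x * B x ∂μ|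
            ≤ 4 * acc * (1 - acc) * (a * b)) := by
  have hab : 0 < a * b := mul_pos ha hb
  have hA' : ∀ x, |A x / a| ≤ 1 := fun x => by
    rw [abs_div, abs_of_pos ha]; exact (div_le_one ha).2 (hA x)
  have hB' : ∀ x, |B x / b| ≤ 1 := fun x => by
    rw [abs_div, abs_of_pos hb]; exact (div_le_one hb).2 (hB x)
  have e1 : ∀ r : X → ℝ, ∫ x, r x * (A x / a * (B x / b)) ∂μ = (∫ x, r x * (A x * B x) ∂μ) / (a * b) :=
    fun r => by
      rw [← integral_div]
      exact integral_congr_ae (Filter.Eventually.of_forall fun x => by ring)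
  have e2 : ∀ r : X → ℝ, ∫ x, r x * (A x / a) ∂μ = (∫ x, r x * A x ∂μ) / a := fun r => by
    rw [← integral_div]
    exact integral_congr_ae (Filter.Eventually.of_forall fun x => by ring)
  have e3 : ∀ r : X → ℝ, ∫ x, r x * (B x / b) ∂μ = (∫ x, r x * B x ∂μ) / b := fun r => by
    rw [← integral_div]
    exact integral_congr_ae (Filter.Eventually.of_forall fun x => by ring)
  have hfac' : ∫ x, q x * (A x / a * (B x / b)) ∂μ
      = (∫ x, q x * (A x / a) ∂μ) * ∫ x, q x * (B x / b) ∂μ := by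
    rw [e1, e2, e3, hfac]; field_simp
  have hcore := curve_core hp0 hpm hpi hp1 hq0 hqm hqi hq1 hacc (hAm.div_const a) (hBm.div_const b)
    hA' hB' hfac'
  rw [e1, e2, e3] at hcore
  set C := ∫ x, p x * (A x * B x) ∂μ - (∫ x, p x * A x ∂μ) * ∫ x, p x * B x ∂μ with hC
  have hcov : (∫ x, p x * (A x * B x) ∂μ) / (a * b) - (∫ x, p x * A x ∂μ) / a * ((∫ x, p x * B x ∂μ) / b)
      = C / (a * b) := by
    rw [hC]; field_simp
  rw [hcov, abs_div, abs_of_pos hab] at hcore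
  refine ⟨?_, fun hacc2 hreg => ?_⟩
  · have h1 := hcore.1
    rw [← mul_div_assoc, div_le_iff₀ hab] at h1
    exact h1
  · have hreg' : 8 / 9 ≤ |C| / (a * b) := by rw [le_div_iff₀ hab]; exact hreg
    have h2 := hcore.2 hacc2 hreg'
    have h3 : |C| / (a * b) ≤ 4 * acc * (1 - acc) := by nlinarith
    rwa [div_le_iff₀ hab] at h3

/-- **THEOREM Q♯♯ (i).**  Hypotheses of `abs_cov_le_of_meanAccept` (THEOREM Q), `a, b > 0`:
`2 |Cov_π(A, B)| ≤ (2 - acc)² · a b` — sharper than THEOREM Q♯'s `4 (1 - acc) a b` for every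
`acc < 2√2 - 2 ≈ 0.83`, with equality on the corner family at `acc = 2/3`. -/
theorem two_mul_abs_cov_le_of_meanAccept (hp0 : ∀ x, 0 ≤ p x) (hpm : Measurable p)
    (hpi : Integrable p μ) (hp1 : ∫ x, p x ∂μ = 1) (hq0 : ∀ x, 0 ≤ q x) (hqm : Measurable q)
    (hqi : Integrable q μ) (hq1 : ∫ x, q x ∂μ = 1) {acc : ℝ}
    (hacc : acc ≤ ∫ x, ∫ y, min (p x * q y) (p y * q x) ∂μ ∂μ) {A B : X → ℝ} (hAm : Measurable A)
    (hBm : Measurable B) {a b : ℝ} (ha : 0 < a) (hb : 0 < b) (hA : ∀ x, |A x| ≤ a)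
    (hB : ∀ x, |B x| ≤ b)
    (hfac : ∫ x, A x * B x ∂(μ.withDensity fun x => ENNReal.ofReal (q x))
      = (∫ x, A x ∂(μ.withDensity fun x => ENNReal.ofReal (q x)))
        * ∫ x, B x ∂(μ.withDensity fun x => ENNReal.ofReal (q x))) :
    2 * |∫ x, A x * B x ∂(μ.withDensity fun x => ENNReal.ofReal (p x))
        - (∫ x, A x ∂(μ.withDensity fun x => ENNReal.ofReal (p x)))
          * ∫ x, B x ∂(μ.withDensity fun x => ENNReal.ofReal (p x))| ≤ (2 - acc) ^ 2 * (a * b) := by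
  simp only [integral_withDensity_ofReal_eq hp0 hpm, integral_withDensity_ofReal_eq hq0 hqm] at hfac ⊢
  exact (curve_scaled hp0 hpm hpi hp1 hq0 hqm hqi hq1 hacc hAm hBm ha hb hA hB hfac).1

/-- **THEOREM Q♯♯ (ii) — THE EXACT CURVE ON `[½, 2/3]`.**  Hypotheses of THEOREM Q, `a, b > 0`,
`acc ≥ ½`: `|Cov_π(A, B)| ≤ max(8/9, 4 acc (1 - acc)) · a b`.  For `½ ≤ acc ≤ 2/3` this reads
`|Cov| ≤ 4 acc (1 - acc) a b`, ATTAINED by the corner family (`AcceptanceFootprintFloor`), so the sharp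
footprint constant `g♯(acc)` EQUALS `4 acc (1 - acc)` there. -/
theorem abs_cov_le_max_of_meanAccept (hp0 : ∀ x, 0 ≤ p x) (hpm : Measurable p)
    (hpi : Integrable p μ) (hp1 : ∫ x, p x ∂μ = 1) (hq0 : ∀ x, 0 ≤ q x) (hqm : Measurable q)
    (hqi : Integrable q μ) (hq1 : ∫ x, q x ∂μ = 1) {acc : ℝ}
    (hacc : acc ≤ ∫ x, ∫ y, min (p x * q y) (p y * q x) ∂μ ∂μ) (hacc2 : 1 / 2 ≤ acc) {A B : X → ℝ}
    (hAm : Measurable A) (hBm : Measurable B) {a b : ℝ} (ha : 0 < a) (hb : 0 < b)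
    (hA : ∀ x, |A x| ≤ a) (hB : ∀ x, |B x| ≤ b)
    (hfac : ∫ x, A x * B x ∂(μ.withDensity fun x => ENNReal.ofReal (q x))
      = (∫ x, A x ∂(μ.withDensity fun x => ENNReal.ofReal (q x)))
        * ∫ x, B x ∂(μ.withDensity fun x => ENNReal.ofReal (q x))) :
    |∫ x, A x * B x ∂(μ.withDensity fun x => ENNReal.ofReal (p x))
        - (∫ x, A x ∂(μ.withDensity fun x => ENNReal.ofReal (p x)))
          * ∫ x, B x ∂(μ.withDensity fun x => ENNReal.ofReal (p x))|
      ≤ max (8 / 9) (4 * acc * (1 - acc)) * (a * b) := by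
  simp only [integral_withDensity_ofReal_eq hp0 hpm, integral_withDensity_ofReal_eq hq0 hqm] at hfac ⊢
  have h := (curve_scaled hp0 hpm hpi hp1 hq0 hqm hqi hq1 hacc hAm hBm ha hb hA hB hfac).2 hacc2
  have hab : 0 ≤ a * b := (mul_pos ha hb).le
  by_cases hreg : 8 / 9 * (a * b)
      ≤ |∫ x, p x * (A x * B x) ∂μ - (∫ x, p x * A x ∂μ) * ∫ x, p x * B x ∂μ|
  · exact (h hreg).trans (mul_le_mul_of_nonneg_right (le_max_right _ _) hab)
  · exact (not_le.1 hreg).le.trans (mul_le_mul_of_nonneg_right (le_max_left _ _) hab)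

/-- **THE ACCEPTANCE CEILING.**  Hypotheses of THEOREM Q, `a, b > 0`: a witness pair with a
FULL-STRENGTH connected correlation `|Cov_π(A, B)| ≥ a b` that the model decorrelates caps the
equilibrium acceptance at `½` (THEOREM Q♯ gave `¾`; `½` is attained by `AcceptanceFootprintFloor`'s
floor family). -/
theorem meanAccept_le_half_of_abs_cov_ge (hp0 : ∀ x, 0 ≤ p x) (hpm : Measurable p)
    (hpi : Integrable p μ) (hp1 : ∫ x, p x ∂μ = 1) (hq0 : ∀ x, 0 ≤ q x) (hqm : Measurable q)
    (hqi : Integrable q μ) (hq1 : ∫ x, q x ∂μ = 1) {acc : ℝ}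
    (hacc : acc ≤ ∫ x, ∫ y, min (p x * q y) (p y * q x) ∂μ ∂μ) {A B : X → ℝ} (hAm : Measurable A)
    (hBm : Measurable B) {a b : ℝ} (ha : 0 < a) (hb : 0 < b) (hA : ∀ x, |A x| ≤ a)
    (hB : ∀ x, |B x| ≤ b)
    (hfac : ∫ x, A x * B x ∂(μ.withDensity fun x => ENNReal.ofReal (q x))
      = (∫ x, A x ∂(μ.withDensity fun x => ENNReal.ofReal (q x)))
        * ∫ x, B x ∂(μ.withDensity fun x => ENNReal.ofReal (q x)))
    (hfull : a * b ≤ |∫ x, A x * B x ∂(μ.withDensity fun x => ENNReal.ofReal (p x))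
        - (∫ x, A x ∂(μ.withDensity fun x => ENNReal.ofReal (p x)))
          * ∫ x, B x ∂(μ.withDensity fun x => ENNReal.ofReal (p x))|) :
    acc ≤ 1 / 2 := by
  simp only [integral_withDensity_ofReal_eq hp0 hpm, integral_withDensity_ofReal_eq hq0 hqm]
    at hfac hfull
  by_contra hlt
  have hlt' : 1 / 2 < acc := not_le.1 hlt
  have hab : 0 < a * b := mul_pos ha hb
  have h := (curve_scaled hp0 hpm hpi hp1 hq0 hqm hqi hq1 hacc hAm hBm ha hb hA hB hfac).2 hlt'.le
    (by nlinarith)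
  have h1 : a * b ≤ 4 * acc * (1 - acc) * (a * b) := hfull.trans h
  nlinarith [mul_pos (sub_pos.2 hlt') (sub_pos.2 hlt'), mul_pos (mul_pos (sub_pos.2 hlt') (sub_pos.2 hlt')) hab]

end Curve

end Summit.Ventures.LatticeQCDFlow.TrivializingMaps.Curve
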